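import Literature.AnabelianGeometry.AbsoluteAnabelian.DiagramMorphismsIsomorphic
import Mathlib.Data.Quot
import Mathlib.Algebra.Group.Basic
import HarnessLib

/-!
# [AbsTopIII] Def 3.5 (v): composition of 1-morphisms and equivalences of diagrams of categories,
# and the GROUP `Aut(𝒟)` of isomorphism classes of self-equivalences

S. Mochizuki, *Topics in absolute anabelian geometry III*, J. Math. Sci. Univ. Tokyo 22 (2015)
[MochizukiAbsTopIII2015], Definition 3.5 (v) pp. 76–77 (manuscript pages, lit key
`paper:url-5493eb38cbb7`): "if `𝒟` is vertex-rigid, then it is natural to speak of the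
*automorphism group* `Aut(𝒟)` of `𝒟`, i.e., the group determined by the isomorphism classes of
self-equivalences of `𝒟`".

Companion of `DiagramMorphisms.lean` (abc-iut-L4-t2), whose `DiagramOfCategories.Aut 𝒟 :=
Quot SelfEquivalence.Isomorphic` is typed with the remark "the group structure is not constructed
here", and of `DiagramMorphismsIsomorphic.lean` (abc-iut-f-095: `Isomorphic` is an equivalence
relation, `Aut.mk_eq_mk_iff`).  This file supplies the remaining 2-categorical bookkeeping of
Def 3.5 (v) over Mathlib's natural-transformation calculus and CONSTRUCTS the group:

* `TwoMorphism.vcomp/whiskerRight/whiskerLeft/hcomp` — vertical and horizontal composites of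
  2-morphisms; `OneMorphism.Isomorphic.comp` — "[2-]isomorphic" is a congruence for composition;
* `TwoMorphism.leftUnitor/rightUnitor/associator` and the unit/associativity laws of composition
  of 1-morphisms up to 2-isomorphism;
* `OneMorphism.IsoOver` — 2-isomorphism of 1-morphisms lying over PROPOSITIONALLY equal morphisms
  of oriented graphs (the shape in which Def 3.5 (v) compares `Ψ ∘ Φ` with an identity
  1-morphism, and in which `SelfEquivalence.Isomorphic` is typed); an equivalence relation and a
  congruence;
* `OneMorphism.IsEquivalence.id/comp/of_isoOver`, `OneMorphism.isEquivalence_of_quasiInverse` —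
  identities, composites and quasi-inverses of equivalences are equivalences, and equivalences are
  stable under 2-isomorphism;
* `SelfEquivalence.id/comp/symm` and `Aut.group : Group 𝒟.Aut` — THE AUTOMORPHISM GROUP of a
  diagram of categories (`[Φ] * [Ψ] = [Φ ∘ Ψ]`, apply `Ψ` first, the convention of Mathlib's
  `CategoryTheory.Aut`; `[Φ]⁻¹` is the class of any quasi-inverse), with the group axioms proved.
  Vertex-rigidity is not needed to DEFINE the group (it makes the 2-cells unique, which is what
  "natural" refers to in print); the construction is for every `𝒟`.

Technical note: the edge 2-cells of `OneMorphism.comp/id` relate functors such as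
`(Φ_v ⋙ Ψ_{Φv}) ⋙ 𝒟''_{(Φ_Γ⃗ ⋙ Ψ_Γ⃗) e}` and `Φ_v ⋙ (Ψ_{Φv} ⋙ 𝒟''_{Ψ_Γ⃗(Φ_Γ⃗ e)})`, equal only
after unfolding `Prefunctor.comp`/`Functor.comp`; the component identities are therefore proved
with `change`/`erw`/`rfl` at default transparency rather than with `simp`.

Pure category theory (abc-iut cell, seat abc-iut-f-095; by-name completion of FACT-LIST row F-0093:
the structural content "Aut(𝒟) is a group" that the row's relation presupposes).  Nothing here
bears on the disputed [IUTchIII] Cor. 3.12 or takes a side; typed ≠ proved elsewhere.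
-/

namespace Literature.AnabelianGeometry.AbsoluteAnabelian

open _root_.CategoryTheory _root_.Quiver

universe v u w

namespace DiagramOfCategories

variable {V : Type w} [Quiver.{v} V] {V' : Type w} [Quiver.{v} V'] {V'' : Type w} [Quiver.{v} V'']
  {V''' : Type w} [Quiver.{v} V''']
  {F : V ⥤q V'} {G : V' ⥤q V''} {H : V'' ⥤q V'''}
  {D : DiagramOfCategories.{v, u, w} V} {D' : DiagramOfCategories.{v, u, w} V'}
  {D'' : DiagramOfCategories.{v, u, w} V''} {D''' : DiagramOfCategories.{v, u, w} V'''}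

/-! ### Component formulae for the structure 2-cells -/

/-- The edge 2-cells `(id_𝒟)_e` have identity components.
[cite: MochizukiAbsTopIII2015, Definition 3.5 (v) p.76] -/
theorem OneMorphism.id_iso_hom_app {a b : V} (e : a ⟶ b) (x : D.obj a) :
    ((OneMorphism.id D).iso e).hom.app x = 𝟙 ((D.map e).obj x) := by
  change 𝟙 _ ≫ 𝟙 _ = _
  exact Category.id_comp _

/-- Components of the edge 2-cells `(Ψ ∘ Φ)_e` of a composite 1-morphism:
`(Ψ_{Φ_Γ⃗ e})_{Φ_{v₁} x}` followed by `Ψ_{Φ_Γ⃗ v₂}((Φ_e)_x)`.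
[cite: MochizukiAbsTopIII2015, Definition 3.5 (v) p.76] -/
theorem OneMorphism.comp_iso_hom_app (Φ : OneMorphism F D D') (Ψ : OneMorphism G D' D'')
    {a b : V} (e : a ⟶ b) (x : D.obj a) :
    ((Φ.comp Ψ).iso e).hom.app x =
      (Ψ.iso (F.map e)).hom.app ((Φ.app a).obj x) ≫ (Ψ.app (F.obj b)).map ((Φ.iso e).hom.app x) := by
  change 𝟙 _ ≫ (Ψ.iso (F.map e)).hom.app ((Φ.app a).obj x) ≫ 𝟙 _ ≫
    (Ψ.app (F.obj b)).map ((Φ.iso e).hom.app x) ≫ 𝟙 _ = _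
  rw [Category.id_comp, Category.id_comp, Category.comp_id]

/-- The defining compatibility of a 2-morphism `Θ : Φ → Ψ` with the edge 2-cells, on components:
`𝒟'_{Φ_Γ⃗ e}((Θ_{v₁})_x) ≫ (Ψ_e)_x = (Φ_e)_x ≫ (Θ_{v₂})_{𝒟_e x}`.
[cite: MochizukiAbsTopIII2015, Definition 3.5 (v) p.76] -/
@[reassoc]
theorem TwoMorphism.naturality_app {Φ Ψ : OneMorphism F D D'} (Θ : TwoMorphism Φ Ψ) {a b : V}
    (e : a ⟶ b) (x : D.obj a) :
    (D'.map (F.map e)).map ((Θ.app a).app x) ≫ (Ψ.iso e).hom.app x =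
      (Φ.iso e).hom.app x ≫ (Θ.app b).app ((D.map e).obj x) := by
  have h := NatTrans.congr_app (Θ.naturality e) x
  dsimp at h
  exact h

/-! ### Vertical and horizontal composition of 2-morphisms; `Isomorphic` is a congruence -/

/-- **Vertical composite** of 2-morphisms `Φ → Ψ → Ξ` (componentwise composition of natural
transformations). [cite: MochizukiAbsTopIII2015, Definition 3.5 (v) p.76] -/
def TwoMorphism.vcomp {Φ Ψ Ξ : OneMorphism F D D'} (Θ₁ : TwoMorphism Φ Ψ) (Θ₂ : TwoMorphism Ψ Ξ) :
    TwoMorphism Φ Ξ where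
  app a := Θ₁.app a ≫ Θ₂.app a
  naturality {a b} e := by
    rw [Functor.whiskerRight_comp, Functor.whiskerLeft_comp, Category.assoc, Θ₂.naturality e,
      reassoc_of% (Θ₁.naturality e)]

/-- **Right whiskering** of a 2-morphism `Θ : Φ → Φ'` by a 1-morphism `Ψ`: the 2-morphism
`Ψ ∘ Φ → Ψ ∘ Φ'` with components `Ψ_{Φ_Γ⃗ v} Θ_v`. [cite: MochizukiAbsTopIII2015, Definition 3.5 (v) p.76] -/
def TwoMorphism.whiskerRight {Φ Φ' : OneMorphism F D D'} (Θ : TwoMorphism Φ Φ')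
    (Ψ : OneMorphism G D' D'') : TwoMorphism (Φ.comp Ψ) (Φ'.comp Ψ) where
  app a := Functor.whiskerRight (Θ.app a) (Ψ.app (F.obj a))
  naturality {a b} e := by
    ext x
    change (D''.map (G.map (F.map e))).map ((Ψ.app (F.obj a)).map ((Θ.app a).app x)) ≫
        ((Φ'.comp Ψ).iso e).hom.app x =
      ((Φ.comp Ψ).iso e).hom.app x ≫ (Ψ.app (F.obj b)).map ((Θ.app b).app ((D.map e).obj x))
    erw [OneMorphism.comp_iso_hom_app, OneMorphism.comp_iso_hom_app,
      (Ψ.iso (F.map e)).hom.naturality_assoc ((Θ.app a).app x), Functor.comp_map, Category.assoc,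
      ← Functor.map_comp, ← Functor.map_comp, Θ.naturality_app]
    rfl

/-- **Left whiskering** of a 2-morphism `Θ' : Ψ → Ψ'` by a 1-morphism `Φ`: the 2-morphism
`Ψ ∘ Φ → Ψ' ∘ Φ` with components `Θ'_{Φ_Γ⃗ v} Φ_v`. [cite: MochizukiAbsTopIII2015, Definition 3.5 (v) p.76] -/
def TwoMorphism.whiskerLeft (Φ : OneMorphism F D D') {Ψ Ψ' : OneMorphism G D' D''}
    (Θ' : TwoMorphism Ψ Ψ') : TwoMorphism (Φ.comp Ψ) (Φ.comp Ψ') where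
  app a := Functor.whiskerLeft (Φ.app a) (Θ'.app (F.obj a))
  naturality {a b} e := by
    ext x
    change (D''.map (G.map (F.map e))).map ((Θ'.app (F.obj a)).app ((Φ.app a).obj x)) ≫
        ((Φ.comp Ψ').iso e).hom.app x =
      ((Φ.comp Ψ).iso e).hom.app x ≫ (Θ'.app (F.obj b)).app ((Φ.app b).obj ((D.map e).obj x))
    erw [OneMorphism.comp_iso_hom_app, OneMorphism.comp_iso_hom_app, ← Category.assoc,
      Θ'.naturality_app (F.map e) ((Φ.app a).obj x), Category.assoc, Category.assoc,
      ← (Θ'.app (F.obj b)).naturality ((Φ.iso e).hom.app x)]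
    rfl

/-- **Horizontal composite of 2-morphisms** `Θ : Φ → Φ'` and `Θ' : Ψ → Ψ'`: the 2-morphism
`Ψ ∘ Φ → Ψ' ∘ Φ'` (right whiskering followed by left whiskering).
[cite: MochizukiAbsTopIII2015, Definition 3.5 (v) p.76] -/
def TwoMorphism.hcomp {Φ Φ' : OneMorphism F D D'} {Ψ Ψ' : OneMorphism G D' D''}
    (Θ : TwoMorphism Φ Φ') (Θ' : TwoMorphism Ψ Ψ') : TwoMorphism (Φ.comp Ψ) (Φ'.comp Ψ') :=
  (Θ.whiskerRight Ψ).vcomp (TwoMorphism.whiskerLeft Φ' Θ')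

/-- The horizontal composite of 2-isomorphisms is a 2-isomorphism.
[cite: MochizukiAbsTopIII2015, Definition 3.5 (v) p.76] -/
theorem TwoMorphism.IsIso.hcomp {Φ Φ' : OneMorphism F D D'} {Ψ Ψ' : OneMorphism G D' D''}
    {Θ : TwoMorphism Φ Φ'} {Θ' : TwoMorphism Ψ Ψ'} (hΘ : Θ.IsIso) (hΘ' : Θ'.IsIso) :
    (Θ.hcomp Θ').IsIso := fun a => by
  haveI := hΘ a
  haveI := hΘ' (F.obj a)
  change CategoryTheory.IsIso (Functor.whiskerRight (Θ.app a) (Ψ.app (F.obj a)) ≫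
    Functor.whiskerLeft (Φ'.app a) (Θ'.app (F.obj a)))
  infer_instance

/-- **"[2-]isomorphic" is a congruence for composition of 1-morphisms**: `Φ ≅ Φ'` and `Ψ ≅ Ψ'`
imply `Ψ ∘ Φ ≅ Ψ' ∘ Φ'`. [cite: MochizukiAbsTopIII2015, Definition 3.5 (v) p.76] -/
theorem OneMorphism.Isomorphic.comp {Φ Φ' : OneMorphism F D D'} {Ψ Ψ' : OneMorphism G D' D''}
    (h : Φ.Isomorphic Φ') (h' : Ψ.Isomorphic Ψ') : (Φ.comp Ψ).Isomorphic (Φ'.comp Ψ') := by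
  obtain ⟨Θ, hΘ⟩ := h
  obtain ⟨Θ', hΘ'⟩ := h'
  exact ⟨Θ.hcomp Θ', hΘ.hcomp hΘ'⟩

/-! ### Unit and associativity 2-cells for composition of 1-morphisms -/

/-- The **left unitor** 2-morphism `Φ ∘ id_𝒟 → Φ` (the composite lives over `id ⋙ Φ_Γ⃗`, which is
`Φ_Γ⃗` definitionally). [cite: MochizukiAbsTopIII2015, Definition 3.5 (v) p.76] -/
def TwoMorphism.leftUnitor (Φ : OneMorphism F D D') :
    TwoMorphism ((OneMorphism.id D).comp Φ) Φ where
  app a := (Φ.app a).leftUnitor.hom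
  naturality {a b} e := by
    ext x
    change (D'.map (F.map e)).map (𝟙 ((Φ.app a).obj x)) ≫ (Φ.iso e).hom.app x =
      (((OneMorphism.id D).comp Φ).iso e).hom.app x ≫ 𝟙 _
    erw [OneMorphism.comp_iso_hom_app, OneMorphism.id_iso_hom_app, Functor.map_id, Functor.map_id,
      Category.id_comp, Category.comp_id, Category.comp_id]
    rfl

/-- The **right unitor** 2-morphism `id_{𝒟'} ∘ Φ → Φ` (over `Φ_Γ⃗ ⋙ id`, definitionally `Φ_Γ⃗`).
[cite: MochizukiAbsTopIII2015, Definition 3.5 (v) p.76] -/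
def TwoMorphism.rightUnitor (Φ : OneMorphism F D D') :
    TwoMorphism (Φ.comp (OneMorphism.id D')) Φ where
  app a := (Φ.app a).rightUnitor.hom
  naturality {a b} e := by
    ext x
    change (D'.map (F.map e)).map (𝟙 ((Φ.app a).obj x)) ≫ (Φ.iso e).hom.app x =
      ((Φ.comp (OneMorphism.id D')).iso e).hom.app x ≫ 𝟙 _
    erw [OneMorphism.comp_iso_hom_app, OneMorphism.id_iso_hom_app, Functor.map_id,
      Category.id_comp, Category.comp_id]

/-- The **associator** 2-morphism `Ξ ∘ (Ψ ∘ Φ) → (Ξ ∘ Ψ) ∘ Φ` (over the definitional equality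
`(Φ_Γ⃗ ⋙ Ψ_Γ⃗) ⋙ Ξ_Γ⃗ = Φ_Γ⃗ ⋙ (Ψ_Γ⃗ ⋙ Ξ_Γ⃗)`).
[cite: MochizukiAbsTopIII2015, Definition 3.5 (v) p.76] -/
def TwoMorphism.associator (Φ : OneMorphism F D D') (Ψ : OneMorphism G D' D'')
    (Ξ : OneMorphism H D'' D''') : TwoMorphism ((Φ.comp Ψ).comp Ξ) (Φ.comp (Ψ.comp Ξ)) where
  app a := (Functor.associator (Φ.app a) (Ψ.app (F.obj a)) (Ξ.app (G.obj (F.obj a)))).hom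
  naturality {a b} e := by
    ext x
    change (D'''.map (H.map (G.map (F.map e)))).map (𝟙 _) ≫ ((Φ.comp (Ψ.comp Ξ)).iso e).hom.app x =
      (((Φ.comp Ψ).comp Ξ).iso e).hom.app x ≫ 𝟙 _
    erw [Functor.map_id, Category.id_comp, Category.comp_id, OneMorphism.comp_iso_hom_app,
      OneMorphism.comp_iso_hom_app, OneMorphism.comp_iso_hom_app, OneMorphism.comp_iso_hom_app,
      Functor.map_comp, Category.assoc]
    rfl

/-- **Unit law (left)**: `Φ ∘ id_𝒟` is [2-]isomorphic to `Φ`.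
[cite: MochizukiAbsTopIII2015, Definition 3.5 (v) p.76] -/
theorem OneMorphism.id_comp_isomorphic (Φ : OneMorphism F D D') :
    ((OneMorphism.id D).comp Φ).Isomorphic Φ :=
  ⟨TwoMorphism.leftUnitor Φ, fun a => by
    change CategoryTheory.IsIso (Φ.app a).leftUnitor.hom
    infer_instance⟩

/-- **Unit law (right)**: `id_{𝒟'} ∘ Φ` is [2-]isomorphic to `Φ`.
[cite: MochizukiAbsTopIII2015, Definition 3.5 (v) p.76] -/
theorem OneMorphism.comp_id_isomorphic (Φ : OneMorphism F D D') :
    (Φ.comp (OneMorphism.id D')).Isomorphic Φ :=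
  ⟨TwoMorphism.rightUnitor Φ, fun a => by
    change CategoryTheory.IsIso (Φ.app a).rightUnitor.hom
    infer_instance⟩

/-- **Associativity law**: `Ξ ∘ (Ψ ∘ Φ)` is [2-]isomorphic to `(Ξ ∘ Ψ) ∘ Φ`.
[cite: MochizukiAbsTopIII2015, Definition 3.5 (v) p.76] -/
theorem OneMorphism.comp_assoc_isomorphic (Φ : OneMorphism F D D') (Ψ : OneMorphism G D' D'')
    (Ξ : OneMorphism H D'' D''') : ((Φ.comp Ψ).comp Ξ).Isomorphic (Φ.comp (Ψ.comp Ξ)) :=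
  ⟨TwoMorphism.associator Φ Ψ Ξ, fun a => by
    change CategoryTheory.IsIso
      (Functor.associator (Φ.app a) (Ψ.app (F.obj a)) (Ξ.app (G.obj (F.obj a)))).hom
    infer_instance⟩

/-! ### 2-isomorphism over propositionally equal morphisms of oriented graphs -/

/-- `Φ` (over `E`) and `Ψ` (over `E'`) are **2-isomorphic over an equality of morphisms of
graphs**: `E = E'` and, after transport along this equality, `Φ` is [2-]isomorphic to `Ψ`.  This is
the shape in which Def 3.5 (v) compares `Ψ ∘ Φ` (over `Φ_Γ⃗ ⋙ Ψ_Γ⃗`) with `id_𝒟` (over the identity),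
and in which `SelfEquivalence.Isomorphic` is typed. [cite: MochizukiAbsTopIII2015, Definition 3.5 (v) p.76] -/
def OneMorphism.IsoOver {E E' : V ⥤q V'} (Φ : OneMorphism E D D') (Ψ : OneMorphism E' D D') : Prop :=
  ∃ h : E = E', (h ▸ Φ).Isomorphic Ψ

/-- Over one morphism of graphs, `IsoOver` is `Isomorphic`. [cite: MochizukiAbsTopIII2015, Definition 3.5 (v) p.76] -/
theorem OneMorphism.isoOver_iff_isomorphic {Φ Ψ : OneMorphism F D D'} :
    Φ.IsoOver Ψ ↔ Φ.Isomorphic Ψ :=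
  ⟨fun ⟨_, h⟩ => h, fun h => ⟨rfl, h⟩⟩

/-- [2-]isomorphic 1-morphisms are isomorphic over `rfl`. [cite: MochizukiAbsTopIII2015, Definition 3.5 (v) p.76] -/
theorem OneMorphism.Isomorphic.isoOver {Φ Ψ : OneMorphism F D D'} (h : Φ.Isomorphic Ψ) :
    Φ.IsoOver Ψ :=
  ⟨rfl, h⟩

/-- `IsoOver` is reflexive. [cite: MochizukiAbsTopIII2015, Definition 3.5 (v) p.76] -/
theorem OneMorphism.IsoOver.refl (Φ : OneMorphism F D D') : Φ.IsoOver Φ :=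
  (OneMorphism.Isomorphic.refl Φ).isoOver

/-- `IsoOver` is symmetric. [cite: MochizukiAbsTopIII2015, Definition 3.5 (v) p.76] -/
theorem OneMorphism.IsoOver.symm {E E' : V ⥤q V'} {Φ : OneMorphism E D D'} {Ψ : OneMorphism E' D D'}
    (h : Φ.IsoOver Ψ) : Ψ.IsoOver Φ := by
  obtain ⟨hE, hiso⟩ := h
  subst hE
  exact ⟨rfl, hiso.symm⟩

/-- `IsoOver` is transitive. [cite: MochizukiAbsTopIII2015, Definition 3.5 (v) p.76] -/
theorem OneMorphism.IsoOver.trans {E E' E'' : V ⥤q V'} {Φ : OneMorphism E D D'}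
    {Ψ : OneMorphism E' D D'} {Ξ : OneMorphism E'' D D'} (h₁ : Φ.IsoOver Ψ) (h₂ : Ψ.IsoOver Ξ) :
    Φ.IsoOver Ξ := by
  obtain ⟨hE, hiso⟩ := h₁
  obtain ⟨hE', hiso'⟩ := h₂
  subst hE
  subst hE'
  exact ⟨rfl, hiso.trans hiso'⟩

/-- `IsoOver` is a congruence for composition of 1-morphisms.
[cite: MochizukiAbsTopIII2015, Definition 3.5 (v) p.76] -/
theorem OneMorphism.IsoOver.comp {E₁ E₂ : V ⥤q V'} {G₁ G₂ : V' ⥤q V''} {Φ₁ : OneMorphism E₁ D D'}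
    {Φ₂ : OneMorphism E₂ D D'} {Ψ₁ : OneMorphism G₁ D' D''} {Ψ₂ : OneMorphism G₂ D' D''}
    (h : Φ₁.IsoOver Φ₂) (h' : Ψ₁.IsoOver Ψ₂) : (Φ₁.comp Ψ₁).IsoOver (Φ₂.comp Ψ₂) := by
  obtain ⟨hE, hiso⟩ := h
  obtain ⟨hG, hiso'⟩ := h'
  subst hE
  subst hG
  exact ⟨rfl, hiso.comp hiso'⟩

/-! ### Equivalences: identity, composites, quasi-inverses, invariance -/

/-- Def 3.5 (v)'s notion of equivalence, rephrased with `IsoOver`: `Φ` is an equivalence iff there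
are `Ψ_Γ⃗` and `Ψ` over it with `Ψ ∘ Φ` isomorphic to `id_𝒟` over `Φ_Γ⃗ ⋙ Ψ_Γ⃗ = id` and `Φ ∘ Ψ`
isomorphic to `id_{𝒟'}` over `Ψ_Γ⃗ ⋙ Φ_Γ⃗ = id`. [cite: MochizukiAbsTopIII2015, Definition 3.5 (v) p.76] -/
theorem OneMorphism.isEquivalence_iff (Φ : OneMorphism F D D') :
    Φ.IsEquivalence ↔ ∃ (G : V' ⥤q V) (Ψ : OneMorphism G D' D),
      (Φ.comp Ψ).IsoOver (OneMorphism.id D) ∧ (Ψ.comp Φ).IsoOver (OneMorphism.id D') := by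
  constructor
  · rintro ⟨G, Ψ, h₁, h₂, i₁, i₂⟩
    exact ⟨G, Ψ, ⟨h₁, i₁⟩, ⟨h₂, i₂⟩⟩
  · rintro ⟨G, Ψ, ⟨h₁, i₁⟩, ⟨h₂, i₂⟩⟩
    exact ⟨G, Ψ, h₁, h₂, i₁, i₂⟩

/-- **The identity 1-morphism is an equivalence** (it is its own quasi-inverse).
[cite: MochizukiAbsTopIII2015, Definition 3.5 (v) p.76] -/
theorem OneMorphism.IsEquivalence.id : (OneMorphism.id D).IsEquivalence :=
  ⟨𝟭q V, OneMorphism.id D, rfl, rfl, OneMorphism.id_comp_isomorphic _,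
    OneMorphism.id_comp_isomorphic _⟩

/-- **A quasi-inverse of an equivalence is an equivalence.**
[cite: MochizukiAbsTopIII2015, Definition 3.5 (v) p.76] -/
theorem OneMorphism.isEquivalence_of_quasiInverse {Φ : OneMorphism F D D'} {G : V' ⥤q V}
    {Ψ : OneMorphism G D' D} (h₁ : (Φ.comp Ψ).IsoOver (OneMorphism.id D))
    (h₂ : (Ψ.comp Φ).IsoOver (OneMorphism.id D')) : Ψ.IsEquivalence :=
  Ψ.isEquivalence_iff.mpr ⟨F, Φ, h₂, h₁⟩

/-- **Composites of equivalences are equivalences**: if `Ψ` is a quasi-inverse of `Φ` and `Ψ'` of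
`Φ'`, then `Ψ ∘ Ψ'` is a quasi-inverse of `Φ' ∘ Φ` (unit and associativity 2-cells, congruence).
[cite: MochizukiAbsTopIII2015, Definition 3.5 (v) p.76] -/
theorem OneMorphism.IsEquivalence.comp {F' : V' ⥤q V''} {Φ : OneMorphism F D D'}
    {Φ' : OneMorphism F' D' D''} (hΦ : Φ.IsEquivalence) (hΦ' : Φ'.IsEquivalence) :
    (Φ.comp Φ').IsEquivalence := by
  obtain ⟨G, Ψ, h₁, h₂⟩ := Φ.isEquivalence_iff.mp hΦ
  obtain ⟨G', Ψ', h₁', h₂'⟩ := Φ'.isEquivalence_iff.mp hΦ'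
  refine (Φ.comp Φ').isEquivalence_iff.mpr ⟨G' ⋙q G, Ψ'.comp Ψ, ?_, ?_⟩
  · have s₁ : ((Φ.comp Φ').comp (Ψ'.comp Ψ)).IsoOver (Φ.comp ((Φ'.comp Ψ').comp Ψ)) :=
      ((OneMorphism.comp_assoc_isomorphic Φ Φ' (Ψ'.comp Ψ)).trans
        ((OneMorphism.Isomorphic.refl Φ).comp
          (OneMorphism.comp_assoc_isomorphic Φ' Ψ' Ψ).symm)).isoOver
    have s₂ : (Φ.comp ((Φ'.comp Ψ').comp Ψ)).IsoOver (Φ.comp ((OneMorphism.id D').comp Ψ)) :=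
      (OneMorphism.IsoOver.refl Φ).comp (h₁'.comp (OneMorphism.IsoOver.refl Ψ))
    have s₃ : (Φ.comp ((OneMorphism.id D').comp Ψ)).IsoOver (Φ.comp Ψ) :=
      ((OneMorphism.Isomorphic.refl Φ).comp (OneMorphism.id_comp_isomorphic Ψ)).isoOver
    exact s₁.trans (s₂.trans (s₃.trans h₁))
  · have s₁ : ((Ψ'.comp Ψ).comp (Φ.comp Φ')).IsoOver (Ψ'.comp ((Ψ.comp Φ).comp Φ')) :=
      ((OneMorphism.comp_assoc_isomorphic Ψ' Ψ (Φ.comp Φ')).trans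
        ((OneMorphism.Isomorphic.refl Ψ').comp
          (OneMorphism.comp_assoc_isomorphic Ψ Φ Φ').symm)).isoOver
    have s₂ : (Ψ'.comp ((Ψ.comp Φ).comp Φ')).IsoOver (Ψ'.comp ((OneMorphism.id D').comp Φ')) :=
      (OneMorphism.IsoOver.refl Ψ').comp (h₂.comp (OneMorphism.IsoOver.refl Φ'))
    have s₃ : (Ψ'.comp ((OneMorphism.id D').comp Φ')).IsoOver (Ψ'.comp Φ') :=
      ((OneMorphism.Isomorphic.refl Ψ').comp (OneMorphism.id_comp_isomorphic Φ')).isoOver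
    exact s₁.trans (s₂.trans (s₃.trans h₂'))

/-- **Equivalences are stable under 2-isomorphism** (over an equality of morphisms of graphs).
[cite: MochizukiAbsTopIII2015, Definition 3.5 (v) p.76] -/
theorem OneMorphism.IsEquivalence.of_isoOver {E : V ⥤q V'} {Φ : OneMorphism F D D'}
    {Φ' : OneMorphism E D D'} (hΦ : Φ.IsEquivalence) (h : Φ.IsoOver Φ') : Φ'.IsEquivalence := by
  obtain ⟨hE, hiso⟩ := h
  subst hE
  obtain ⟨G, Ψ, h₁, h₂⟩ := Φ.isEquivalence_iff.mp hΦ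
  refine Φ'.isEquivalence_iff.mpr ⟨G, Ψ, ?_, ?_⟩
  · exact (hiso.symm.comp (OneMorphism.Isomorphic.refl Ψ)).isoOver.trans h₁
  · exact ((OneMorphism.Isomorphic.refl Ψ).comp hiso.symm).isoOver.trans h₂

/-! ### Self-equivalences: identity, composition, quasi-inverse -/

/-- **The identity self-equivalence** of `𝒟`. [cite: MochizukiAbsTopIII2015, Definition 3.5 (v) p.77] -/
protected def SelfEquivalence.id (D : DiagramOfCategories.{v, u, w} V) : D.SelfEquivalence :=
  ⟨𝟭q V, OneMorphism.id D, OneMorphism.IsEquivalence.id⟩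

/-- **Composition of self-equivalences** `Ψ ∘ Φ` (first `Φ`, then `Ψ`).
[cite: MochizukiAbsTopIII2015, Definition 3.5 (v) p.77] -/
def SelfEquivalence.comp (Φ Ψ : D.SelfEquivalence) : D.SelfEquivalence :=
  ⟨Φ.graphMap ⋙q Ψ.graphMap, Φ.hom.comp Ψ.hom, Φ.isEquivalence.comp Ψ.isEquivalence⟩

/-- `SelfEquivalence.Isomorphic` is `IsoOver` of the underlying 1-morphisms (by definition).
[cite: MochizukiAbsTopIII2015, Definition 3.5 (v) p.77] -/
theorem SelfEquivalence.isomorphic_iff_isoOver {Φ Ψ : D.SelfEquivalence} :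
    Φ.Isomorphic Ψ ↔ Φ.hom.IsoOver Ψ.hom :=
  Iff.rfl

/-- Isomorphism of self-equivalences is a **congruence for composition**.
[cite: MochizukiAbsTopIII2015, Definition 3.5 (v) p.77] -/
theorem SelfEquivalence.Isomorphic.comp {Φ₁ Φ₂ Ψ₁ Ψ₂ : D.SelfEquivalence} (h : Φ₁.Isomorphic Φ₂)
    (h' : Ψ₁.Isomorphic Ψ₂) : (Φ₁.comp Ψ₁).Isomorphic (Φ₂.comp Ψ₂) :=
  SelfEquivalence.isomorphic_iff_isoOver.mpr
    ((SelfEquivalence.isomorphic_iff_isoOver.mp h).comp (SelfEquivalence.isomorphic_iff_isoOver.mp h'))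

/-- Composition of self-equivalences is associative up to isomorphism.
[cite: MochizukiAbsTopIII2015, Definition 3.5 (v) p.77] -/
theorem SelfEquivalence.comp_assoc_isomorphic (Φ Ψ Ξ : D.SelfEquivalence) :
    ((Φ.comp Ψ).comp Ξ).Isomorphic (Φ.comp (Ψ.comp Ξ)) :=
  SelfEquivalence.isomorphic_iff_isoOver.mpr
    (OneMorphism.comp_assoc_isomorphic Φ.hom Ψ.hom Ξ.hom).isoOver

/-- The identity self-equivalence is a left unit up to isomorphism.
[cite: MochizukiAbsTopIII2015, Definition 3.5 (v) p.77] -/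
theorem SelfEquivalence.id_comp_isomorphic (Φ : D.SelfEquivalence) :
    ((SelfEquivalence.id D).comp Φ).Isomorphic Φ :=
  SelfEquivalence.isomorphic_iff_isoOver.mpr (OneMorphism.id_comp_isomorphic Φ.hom).isoOver

/-- The identity self-equivalence is a right unit up to isomorphism.
[cite: MochizukiAbsTopIII2015, Definition 3.5 (v) p.77] -/
theorem SelfEquivalence.comp_id_isomorphic (Φ : D.SelfEquivalence) :
    (Φ.comp (SelfEquivalence.id D)).Isomorphic Φ :=
  SelfEquivalence.isomorphic_iff_isoOver.mpr (OneMorphism.comp_id_isomorphic Φ.hom).isoOver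

/-- **A chosen quasi-inverse** `Φ⁻¹` of a self-equivalence (the `Ψ` of Def 3.5 (v), obtained by
choice from the existential `IsEquivalence`); it is again a self-equivalence.
[cite: MochizukiAbsTopIII2015, Definition 3.5 (v) p.77] -/
noncomputable def SelfEquivalence.symm (Φ : D.SelfEquivalence) : D.SelfEquivalence :=
  ⟨(Φ.hom.isEquivalence_iff.mp Φ.isEquivalence).choose,
    (Φ.hom.isEquivalence_iff.mp Φ.isEquivalence).choose_spec.choose,
    OneMorphism.isEquivalence_of_quasiInverse
      (Φ.hom.isEquivalence_iff.mp Φ.isEquivalence).choose_spec.choose_spec.1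
      (Φ.hom.isEquivalence_iff.mp Φ.isEquivalence).choose_spec.choose_spec.2⟩

/-- `Φ⁻¹ ∘ Φ ≅ id_𝒟`. [cite: MochizukiAbsTopIII2015, Definition 3.5 (v) p.77] -/
theorem SelfEquivalence.comp_symm_isomorphic_id (Φ : D.SelfEquivalence) :
    (Φ.comp Φ.symm).Isomorphic (SelfEquivalence.id D) :=
  SelfEquivalence.isomorphic_iff_isoOver.mpr
    (Φ.hom.isEquivalence_iff.mp Φ.isEquivalence).choose_spec.choose_spec.1

/-- `Φ ∘ Φ⁻¹ ≅ id_𝒟`. [cite: MochizukiAbsTopIII2015, Definition 3.5 (v) p.77] -/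
theorem SelfEquivalence.symm_comp_isomorphic_id (Φ : D.SelfEquivalence) :
    (Φ.symm.comp Φ).Isomorphic (SelfEquivalence.id D) :=
  SelfEquivalence.isomorphic_iff_isoOver.mpr
    (Φ.hom.isEquivalence_iff.mp Φ.isEquivalence).choose_spec.choose_spec.2

/-! ### The automorphism group `Aut(𝒟)` -/

/-- The class `[Φ] ∈ Aut(𝒟)` of a self-equivalence. [cite: MochizukiAbsTopIII2015, Definition 3.5 (v) p.77] -/
def Aut.mk (Φ : D.SelfEquivalence) : D.Aut :=
  Quot.mk _ Φ

/-- Every element of `Aut(𝒟)` is the class of a self-equivalence.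
[cite: MochizukiAbsTopIII2015, Definition 3.5 (v) p.77] -/
theorem Aut.exists_mk (x : D.Aut) : ∃ Φ : D.SelfEquivalence, Aut.mk Φ = x :=
  Quot.exists_rep x

/-- `[Φ] = [Ψ]` iff `Φ ≅ Ψ`. [cite: MochizukiAbsTopIII2015, Definition 3.5 (v) p.77] -/
theorem Aut.mk_eq_mk {Φ Ψ : D.SelfEquivalence} : Aut.mk Φ = Aut.mk Ψ ↔ Φ.Isomorphic Ψ :=
  Aut.mk_eq_mk_iff Φ Ψ

/-- The unit of `Aut(𝒟)`: the class of the identity self-equivalence.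
[cite: MochizukiAbsTopIII2015, Definition 3.5 (v) p.77] -/
protected def Aut.one : D.Aut :=
  Aut.mk (SelfEquivalence.id D)

/-- The product in `Aut(𝒟)`: `[Φ] * [Ψ] = [Φ ∘ Ψ]` (apply `Ψ` first, then `Φ` — the convention of
Mathlib's `CategoryTheory.Aut`), well defined because isomorphism of self-equivalences is a
congruence for composition. [cite: MochizukiAbsTopIII2015, Definition 3.5 (v) p.77] -/
protected def Aut.mul : D.Aut → D.Aut → D.Aut :=
  Quot.map₂ (fun Φ Ψ : D.SelfEquivalence => Ψ.comp Φ)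
    (fun Φ _ _ h => h.comp (SelfEquivalence.Isomorphic.refl Φ))
    (fun _ _ Ψ h => (SelfEquivalence.Isomorphic.refl Ψ).comp h)

/-- The inverse in `Aut(𝒟)`: the class of a quasi-inverse of (a representative of) the class.
[cite: MochizukiAbsTopIII2015, Definition 3.5 (v) p.77] -/
protected noncomputable def Aut.inv (x : D.Aut) : D.Aut :=
  Aut.mk (Quot.out x).symm

/-- `[Φ] * [Ψ] = [Φ ∘ Ψ]`. [cite: MochizukiAbsTopIII2015, Definition 3.5 (v) p.77] -/
theorem Aut.mul_mk (Φ Ψ : D.SelfEquivalence) :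
    Aut.mul (Aut.mk Φ) (Aut.mk Ψ) = Aut.mk (Ψ.comp Φ) :=
  rfl

/-- **`Aut(𝒟)` is a group** ([AbsTopIII] Def 3.5 (v): "the automorphism group `Aut(𝒟)` of `𝒟`,
i.e., the group determined by the isomorphism classes of self-equivalences of `𝒟`"): classes of
self-equivalences under composition, unit the class of the identity, inverse the class of a
quasi-inverse. [cite: MochizukiAbsTopIII2015, Definition 3.5 (v) p.77] -/
noncomputable instance Aut.group : Group D.Aut where
  mul := Aut.mul
  one := Aut.one
  inv := Aut.inv
  mul_assoc := by
    rintro ⟨Φ⟩ ⟨Ψ⟩ ⟨Ξ⟩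
    exact Quot.sound (SelfEquivalence.comp_assoc_isomorphic Ξ Ψ Φ).symm
  one_mul := by
    rintro ⟨Φ⟩
    exact Quot.sound (SelfEquivalence.comp_id_isomorphic Φ)
  mul_one := by
    rintro ⟨Φ⟩
    exact Quot.sound (SelfEquivalence.id_comp_isomorphic Φ)
  inv_mul_cancel := by
    rintro ⟨Φ⟩
    have hO : (Quot.out (Quot.mk SelfEquivalence.Isomorphic Φ : D.Aut)).Isomorphic Φ :=
      (Aut.mk_eq_mk_iff _ _).mp (Quot.out_eq _)
    exact Quot.sound ((hO.symm.comp (SelfEquivalence.Isomorphic.refl _)).trans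
      (SelfEquivalence.comp_symm_isomorphic_id _))

/-- In the group `Aut(𝒟)`: `[Φ] * [Ψ] = [Φ ∘ Ψ]`. [cite: MochizukiAbsTopIII2015, Definition 3.5 (v) p.77] -/
theorem Aut.mk_mul_mk (Φ Ψ : D.SelfEquivalence) : Aut.mk Φ * Aut.mk Ψ = Aut.mk (Ψ.comp Φ) :=
  rfl

/-- In the group `Aut(𝒟)`: `1 = [id_𝒟]`. [cite: MochizukiAbsTopIII2015, Definition 3.5 (v) p.77] -/
theorem Aut.one_eq_mk : (1 : D.Aut) = Aut.mk (SelfEquivalence.id D) :=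
  rfl

/-- In the group `Aut(𝒟)`: `[Φ]⁻¹ = [Φ⁻¹]` for the chosen quasi-inverse `Φ⁻¹ = Φ.symm` (any two
quasi-inverses having the same class). [cite: MochizukiAbsTopIII2015, Definition 3.5 (v) p.77] -/
theorem Aut.mk_inv (Φ : D.SelfEquivalence) : (Aut.mk Φ)⁻¹ = Aut.mk Φ.symm := by
  rw [inv_eq_iff_mul_eq_one, Aut.mk_mul_mk, Aut.one_eq_mk, Aut.mk_eq_mk]
  exact SelfEquivalence.symm_comp_isomorphic_id Φ

end DiagramOfCategories

end Literature.AnabelianGeometry.AbsoluteAnabelian
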